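import Summits.BirchSwinnertonDyer.BirchSwinnertonDyer.Theorems.EisensteinPrimesMazurMCOnCellBTwistbackReachableCell70971a
import Summits.BirchSwinnertonDyer.BirchSwinnertonDyer.Theorems.EisensteinPrimesMazurMCOnCellBTwistbackReachableCell163461d
import Summits.BirchSwinnertonDyer.BirchSwinnertonDyer.Theorems.EisensteinPrimesMazurMCOnCellBTwistbackReachableCell105861e
import Summits.BirchSwinnertonDyer.BirchSwinnertonDyer.Theorems.EisensteinPrimesMazurMCOnCellBTwistbackDefectSwapZigzag
import HarnessLib

/-!
# Crux 3 `MazurMCOnCellB` (stmt-BirchSwinnertonDyer-19033), line `twistback` v10 (LEAD x2-p1 g14, REGISTERED 2026-08-28T22:20:15Z,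
# sha256 5c167aac…) — the three A10 classes with a road-(e) unit end on file (`70971a`, `163461d`, `105861e`) sit inside the
# EXCLUDED population of the REGISTERED stub 6⁵ `stub_upperPartnerOffSubrowNoConnectedClassShaUnit` (zig-zag currency), every
# globally minimal member, modulo width seat x2-p1-w5 g3's instrument readings

Width seat `bsd-line-x2-p1-w8` (gen 4), cell `bsd-eis`, 2026-08-28; L4-style currency update of this seat's per-class files p672107
(`…ReachableCell70971a`), p672520 (`…ReachableCell163461d`), p673631 (`…ReachableCell105861e`) after the reshape v9 → v10;
`--supports stmt-BirchSwinnertonDyer-19033 --as helper`. THEOREMS ONLY, fact-free: no `def`, no named fact, no `sorry`.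

WHAT (numbers). v10's one kernel stub 6⁵ replaces v9's forward chain `Relation.ReflTransGen (TwoStepAt p) W₁ W″` in the negated
datum by the ZIG-ZAG relation `Relation.ReflTransGen (fun A B ↦ TwoStepAt p A B ∨ (TwoStepAt p B A ∧ X2.CellB B p)) W₁ W″`
(width seat x2-p1-w3 g14's p671590 `…TwistbackDefectSwapZigzag`, VERBATIM); every forward chain is a zig-zag
(`zigzag_of_reflTransGen_twoStepAt`, ibid.), so the v9 datum of this seat's `reachableClassShaUnit_of_isIsogenous_<class>1`
theorems gives the v10 datum at once. Below, for each of the three classes: the v10 negated datum (statement shape VERBATIM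
the registered stub's, at `p = 3`) at EVERY globally minimal curve `ℚ`-isogenous to the first Cremona member
(`connectedClassShaUnit_of_isIsogenous_<class>1`, from the THREE readings `hrd`, `hL`, `hunit` of the class's display) and at
the second Cremona member explicitly (`connectedClassShaUnit_<class>2`, via x2-p1-w7 g3's kernel isogeny certificates
p671549 / the tree's `X2.SecondDescentDisplay105861e.isIsogenous_E₁_E₂`). The Mazur-MC / `BSD(E,3)` heads of the three
per-class files are unchanged by the reshape (they conclude `X2.MazurMainConjectureAt` / `BSDp`, not the stub) and are not repeated.

HONEST FRAMING: CONDITIONAL on the instrument readings exactly as in p672107 / p672520 / p673631 (x2-p1-w5 g3's numerics p668413,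
p671595, (H5) `…UnitEndCell105861e1`; NOT kernel-certified); no named fact enters these six theorems; nothing is booked, no cell /
label / tier moves; no registered stub is closed (6⁵ is asked OFF this population); no summit statement, no Mazur main
conjecture and no case of BSD is proved for any curve by this file.

References: [SilvermanAEC2009] III.4, III.6; [Velu1971]; [CremonaAlgorithms1997] Table 1 (classes 70971a, 163461d, 105861e).
-/

set_option autoImplicit false

-- `Summit.BirchSwinnertonDyer.BirchSwinnertonDyer.…`: the summit and its single sub-problem share a name.
set_option linter.dupNamespace false

noncomputable section

open scoped Classical

open WeierstrassCurve NumberField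
  Literature.NumberTheory.EllipticCurves
  Literature.NumberTheory.EllipticCurves.Rank1Residual
  Literature.NumberTheory.EllipticCurves.Rank1Residual.Typed
  Summit.BirchSwinnertonDyer.Rank1Residual
  Summit.BirchSwinnertonDyer.BirchSwinnertonDyer.Theses
  Summit.BirchSwinnertonDyer.BirchSwinnertonDyer.Theorems
  Summit.BirchSwinnertonDyer.BirchSwinnertonDyer.Theorems.EisensteinPrimesMazurMCOnCellBTwistbackTwoStepDefs
  Summit.BirchSwinnertonDyer.BirchSwinnertonDyer.Theorems.EisensteinPrimesMazurMCOnCellBTwistbackDefectSwapZigzag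
  Summit.BirchSwinnertonDyer.BirchSwinnertonDyer.Theorems.EisensteinPrimesA10IsogenyCertificates01

namespace Summit.BirchSwinnertonDyer.BirchSwinnertonDyer.Theorems.EisensteinPrimesMazurMCOnCellBTwistbackConnectedCells

/-! ## §1 Class `70971a` (p672107) in v10 currency -/

/-- **Every globally minimal curve `ℚ`-isogenous to `70971a1` lies in v10's EXCLUDED population at `p = 3`** — the negated datum
of the registered stub 6⁵ `stub_upperPartnerOffSubrowNoConnectedClassShaUnit` (zig-zag connectivity to a Ш-unit class, statement
shape verbatim at `p = 3`), from the THREE readings of the class's display (`hrd`, `hL`, `hunit`): p672107's forward-chain datum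
`reachableClassShaUnit_of_isIsogenous_70971a1` made a zig-zag by x2-p1-w3 g14's `zigzag_of_reflTransGen_twoStepAt` (p671590).
Fact-free; CONDITIONAL on the readings only; nothing booked. [cite: SilvermanAEC2009, III.4 and III.6] [cite: CremonaAlgorithms1997, Table 1 (class 70971a)] -/
theorem connectedClassShaUnit_of_isIsogenous_70971a1
    (W : WeierstrassCurve ℚ) [W.IsElliptic] [W.IsGloballyMinimal] (hW : W = ⟨0, 1, 1, 61, -1546⟩)
    (Wd : WeierstrassCurve ℚ) [Wd.IsElliptic] [Wd.IsGloballyMinimal] (hWd : Wd = ⟨0, 1, 1, 1041101, 3520878355⟩)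
    (hrd : Wd.analyticRank = 1) (hL : (Wd.quadraticTwist ((-23 : ℤ) : ℚ)).entireLFunction 1 ≠ 0)
    (W'' : WeierstrassCurve ℚ) [W''.IsElliptic] [W''.IsGloballyMinimal] (hW'' : W'' = ⟨0, 1, 1, 550742253, -42834121009855⟩)
    (hunit : ∃ q : ℚ, shaAn W'' = (q : ℂ) ∧ padicValRat 3 q = 0)
    (W' : WeierstrassCurve ℚ) [W'.IsElliptic] [W'.IsGloballyMinimal] (hiso : IsIsogenous W W') :
    ∃ (W₁ : WeierstrassCurve ℚ) (_ : W₁.IsElliptic) (_ : W₁.IsGloballyMinimal)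
      (W₃ : WeierstrassCurve ℚ) (_ : W₃.IsElliptic) (_ : W₃.IsGloballyMinimal)
      (Wc : WeierstrassCurve ℚ) (_ : Wc.IsElliptic) (_ : Wc.IsGloballyMinimal),
      IsIsogenous W' W₁ ∧
      Relation.ReflTransGen (fun A B : WeierstrassCurve ℚ ↦ TwoStepAt 3 A B ∨
        (TwoStepAt 3 B A ∧ ∃ (_ : B.IsElliptic) (_ : B.IsGloballyMinimal), X2.CellB B 3)) W₁ W₃ ∧
      IsIsogenous W₃ Wc ∧
      ∃ q : ℚ, shaAn Wc = (q : ℂ) ∧ padicValRat 3 q = 0 := by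
  obtain ⟨W₁, _, _, W₃, _, _, Wc, _, _, hiso₁, hchain, hisoc, hq⟩ :=
    EisensteinPrimesMazurMCOnCellBTwistbackReachableCell70971a.reachableClassShaUnit_of_isIsogenous_70971a1 W hW Wd hWd hrd hL W'' hW'' hunit W' hiso
  exact ⟨W₁, inferInstance, inferInstance, W₃, inferInstance, inferInstance, Wc, inferInstance, inferInstance, hiso₁,
    zigzag_of_reflTransGen_twoStepAt hchain, hisoc, hq⟩

/-- **`(70971a1, 3)` and `(70971a2, 3)` — both Cremona members of class `70971a` — lie in v10's EXCLUDED population**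
(modulo the three readings): the identity isogeny (`WeierstrassCurve.isIsogenous_self`) resp. p671549 `isIsogenous_70971a1_70971a2` fed to
`connectedClassShaUnit_of_isIsogenous_70971a1`. Fact-free; nothing booked. [cite: Velu1971] [cite: CremonaAlgorithms1997, Table 1 (class 70971a)] -/
theorem connectedClassShaUnit_70971a_members
    (W : WeierstrassCurve ℚ) [W.IsElliptic] [W.IsGloballyMinimal] (hW : W = ⟨0, 1, 1, 61, -1546⟩)
    (Wd : WeierstrassCurve ℚ) [Wd.IsElliptic] [Wd.IsGloballyMinimal] (hWd : Wd = ⟨0, 1, 1, 1041101, 3520878355⟩)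
    (hrd : Wd.analyticRank = 1) (hL : (Wd.quadraticTwist ((-23 : ℤ) : ℚ)).entireLFunction 1 ≠ 0)
    (W'' : WeierstrassCurve ℚ) [W''.IsElliptic] [W''.IsGloballyMinimal] (hW'' : W'' = ⟨0, 1, 1, 550742253, -42834121009855⟩)
    (hunit : ∃ q : ℚ, shaAn W'' = (q : ℂ) ∧ padicValRat 3 q = 0)
    (W₂ : WeierstrassCurve ℚ) [W₂.IsElliptic] [W₂.IsGloballyMinimal] (hW₂ : W₂ = ⟨0, 1, 1, -8549, -307201⟩) :
    (∃ (W₁ : WeierstrassCurve ℚ) (_ : W₁.IsElliptic) (_ : W₁.IsGloballyMinimal)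
      (W₃ : WeierstrassCurve ℚ) (_ : W₃.IsElliptic) (_ : W₃.IsGloballyMinimal)
      (Wc : WeierstrassCurve ℚ) (_ : Wc.IsElliptic) (_ : Wc.IsGloballyMinimal),
      IsIsogenous W W₁ ∧
      Relation.ReflTransGen (fun A B : WeierstrassCurve ℚ ↦ TwoStepAt 3 A B ∨
        (TwoStepAt 3 B A ∧ ∃ (_ : B.IsElliptic) (_ : B.IsGloballyMinimal), X2.CellB B 3)) W₁ W₃ ∧
      IsIsogenous W₃ Wc ∧
      ∃ q : ℚ, shaAn Wc = (q : ℂ) ∧ padicValRat 3 q = 0) ∧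
    (∃ (W₁ : WeierstrassCurve ℚ) (_ : W₁.IsElliptic) (_ : W₁.IsGloballyMinimal)
      (W₃ : WeierstrassCurve ℚ) (_ : W₃.IsElliptic) (_ : W₃.IsGloballyMinimal)
      (Wc : WeierstrassCurve ℚ) (_ : Wc.IsElliptic) (_ : Wc.IsGloballyMinimal),
      IsIsogenous W₂ W₁ ∧
      Relation.ReflTransGen (fun A B : WeierstrassCurve ℚ ↦ TwoStepAt 3 A B ∨
        (TwoStepAt 3 B A ∧ ∃ (_ : B.IsElliptic) (_ : B.IsGloballyMinimal), X2.CellB B 3)) W₁ W₃ ∧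
      IsIsogenous W₃ Wc ∧
      ∃ q : ℚ, shaAn Wc = (q : ℂ) ∧ padicValRat 3 q = 0) := by
  have hiso : IsIsogenous W W₂ := by rw [hW₂, hW]; exact isIsogenous_70971a1_70971a2
  exact ⟨connectedClassShaUnit_of_isIsogenous_70971a1 W hW Wd hWd hrd hL W'' hW'' hunit W (WeierstrassCurve.isIsogenous_self W),
    connectedClassShaUnit_of_isIsogenous_70971a1 W hW Wd hWd hrd hL W'' hW'' hunit W₂ hiso⟩

/-! ## §2 Class `163461d` (p672520) in v10 currency -/

/-- **Every globally minimal curve `ℚ`-isogenous to `163461d1` lies in v10's EXCLUDED population at `p = 3`** — the negated datum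
of the registered stub 6⁵ `stub_upperPartnerOffSubrowNoConnectedClassShaUnit` (zig-zag connectivity to a Ш-unit class, statement
shape verbatim at `p = 3`), from the THREE readings of the class's display (`hrd`, `hL`, `hunit`): p672520's forward-chain datum
`reachableClassShaUnit_of_isIsogenous_163461d1` made a zig-zag by x2-p1-w3 g14's `zigzag_of_reflTransGen_twoStepAt` (p671590).
Fact-free; CONDITIONAL on the readings only; nothing booked. [cite: SilvermanAEC2009, III.4 and III.6] [cite: CremonaAlgorithms1997, Table 1 (class 163461d)] -/
theorem connectedClassShaUnit_of_isIsogenous_163461d1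
    (W : WeierstrassCurve ℚ) [W.IsElliptic] [W.IsGloballyMinimal] (hW : W = ⟨0, 1, 1, -56779, 5139994⟩)
    (Wd : WeierstrassCurve ℚ) [Wd.IsElliptic] [Wd.IsGloballyMinimal] (hWd : Wd = ⟨0, 1, 1, -6870299, -6868813495⟩)
    (hrd : Wd.analyticRank = 1) (hL : (Wd.quadraticTwist ((-227 : ℤ) : ℚ)).entireLFunction 1 ≠ 0)
    (W'' : WeierstrassCurve ℚ) [W''.IsElliptic] [W''.IsGloballyMinimal] (hW'' : W'' = ⟨0, 1, 1, -354019654347, 80318176066313642⟩)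
    (hunit : ∃ q : ℚ, shaAn W'' = (q : ℂ) ∧ padicValRat 3 q = 0)
    (W' : WeierstrassCurve ℚ) [W'.IsElliptic] [W'.IsGloballyMinimal] (hiso : IsIsogenous W W') :
    ∃ (W₁ : WeierstrassCurve ℚ) (_ : W₁.IsElliptic) (_ : W₁.IsGloballyMinimal)
      (W₃ : WeierstrassCurve ℚ) (_ : W₃.IsElliptic) (_ : W₃.IsGloballyMinimal)
      (Wc : WeierstrassCurve ℚ) (_ : Wc.IsElliptic) (_ : Wc.IsGloballyMinimal),
      IsIsogenous W' W₁ ∧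
      Relation.ReflTransGen (fun A B : WeierstrassCurve ℚ ↦ TwoStepAt 3 A B ∨
        (TwoStepAt 3 B A ∧ ∃ (_ : B.IsElliptic) (_ : B.IsGloballyMinimal), X2.CellB B 3)) W₁ W₃ ∧
      IsIsogenous W₃ Wc ∧
      ∃ q : ℚ, shaAn Wc = (q : ℂ) ∧ padicValRat 3 q = 0 := by
  obtain ⟨W₁, _, _, W₃, _, _, Wc, _, _, hiso₁, hchain, hisoc, hq⟩ :=
    EisensteinPrimesMazurMCOnCellBTwistbackReachableCell163461d.reachableClassShaUnit_of_isIsogenous_163461d1 W hW Wd hWd hrd hL W'' hW'' hunit W' hiso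
  exact ⟨W₁, inferInstance, inferInstance, W₃, inferInstance, inferInstance, Wc, inferInstance, inferInstance, hiso₁,
    zigzag_of_reflTransGen_twoStepAt hchain, hisoc, hq⟩

/-- **`(163461d1, 3)` and `(163461d2, 3)` — both Cremona members of class `163461d` — lie in v10's EXCLUDED population**
(modulo the three readings): the identity isogeny (`WeierstrassCurve.isIsogenous_self`) resp. p671549 `isIsogenous_163461d1_163461d2` fed to
`connectedClassShaUnit_of_isIsogenous_163461d1`. Fact-free; nothing booked. [cite: Velu1971] [cite: CremonaAlgorithms1997, Table 1 (class 163461d)] -/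
theorem connectedClassShaUnit_163461d_members
    (W : WeierstrassCurve ℚ) [W.IsElliptic] [W.IsGloballyMinimal] (hW : W = ⟨0, 1, 1, -56779, 5139994⟩)
    (Wd : WeierstrassCurve ℚ) [Wd.IsElliptic] [Wd.IsGloballyMinimal] (hWd : Wd = ⟨0, 1, 1, -6870299, -6868813495⟩)
    (hrd : Wd.analyticRank = 1) (hL : (Wd.quadraticTwist ((-227 : ℤ) : ℚ)).entireLFunction 1 ≠ 0)
    (W'' : WeierstrassCurve ℚ) [W''.IsElliptic] [W''.IsGloballyMinimal] (hW'' : W'' = ⟨0, 1, 1, -354019654347, 80318176066313642⟩)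
    (hunit : ∃ q : ℚ, shaAn W'' = (q : ℂ) ∧ padicValRat 3 q = 0)
    (W₂ : WeierstrassCurve ℚ) [W₂.IsElliptic] [W₂.IsGloballyMinimal] (hW₂ : W₂ = ⟨0, 1, 1, -421789, -102720461⟩) :
    (∃ (W₁ : WeierstrassCurve ℚ) (_ : W₁.IsElliptic) (_ : W₁.IsGloballyMinimal)
      (W₃ : WeierstrassCurve ℚ) (_ : W₃.IsElliptic) (_ : W₃.IsGloballyMinimal)
      (Wc : WeierstrassCurve ℚ) (_ : Wc.IsElliptic) (_ : Wc.IsGloballyMinimal),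
      IsIsogenous W W₁ ∧
      Relation.ReflTransGen (fun A B : WeierstrassCurve ℚ ↦ TwoStepAt 3 A B ∨
        (TwoStepAt 3 B A ∧ ∃ (_ : B.IsElliptic) (_ : B.IsGloballyMinimal), X2.CellB B 3)) W₁ W₃ ∧
      IsIsogenous W₃ Wc ∧
      ∃ q : ℚ, shaAn Wc = (q : ℂ) ∧ padicValRat 3 q = 0) ∧
    (∃ (W₁ : WeierstrassCurve ℚ) (_ : W₁.IsElliptic) (_ : W₁.IsGloballyMinimal)
      (W₃ : WeierstrassCurve ℚ) (_ : W₃.IsElliptic) (_ : W₃.IsGloballyMinimal)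
      (Wc : WeierstrassCurve ℚ) (_ : Wc.IsElliptic) (_ : Wc.IsGloballyMinimal),
      IsIsogenous W₂ W₁ ∧
      Relation.ReflTransGen (fun A B : WeierstrassCurve ℚ ↦ TwoStepAt 3 A B ∨
        (TwoStepAt 3 B A ∧ ∃ (_ : B.IsElliptic) (_ : B.IsGloballyMinimal), X2.CellB B 3)) W₁ W₃ ∧
      IsIsogenous W₃ Wc ∧
      ∃ q : ℚ, shaAn Wc = (q : ℂ) ∧ padicValRat 3 q = 0) := by
  have hiso : IsIsogenous W W₂ := by rw [hW₂, hW]; exact isIsogenous_163461d1_163461d2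
  exact ⟨connectedClassShaUnit_of_isIsogenous_163461d1 W hW Wd hWd hrd hL W'' hW'' hunit W (WeierstrassCurve.isIsogenous_self W),
    connectedClassShaUnit_of_isIsogenous_163461d1 W hW Wd hWd hrd hL W'' hW'' hunit W₂ hiso⟩

/-! ## §3 Class `105861e` (p673631) in v10 currency -/

/-- **Every globally minimal curve `ℚ`-isogenous to `105861e1` lies in v10's EXCLUDED population at `p = 3`** — the negated datum
of the registered stub 6⁵ `stub_upperPartnerOffSubrowNoConnectedClassShaUnit` (zig-zag connectivity to a Ш-unit class, statement
shape verbatim at `p = 3`), from the THREE readings of the class's display (`hrd`, `hL`, `hunit`): p673631's forward-chain datum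
`reachableClassShaUnit_of_isIsogenous_105861e1` made a zig-zag by x2-p1-w3 g14's `zigzag_of_reflTransGen_twoStepAt` (p671590).
Fact-free; CONDITIONAL on the readings only; nothing booked. [cite: SilvermanAEC2009, III.4 and III.6] [cite: CremonaAlgorithms1997, Table 1 (class 105861e)] -/
theorem connectedClassShaUnit_of_isIsogenous_105861e1
    (W : WeierstrassCurve ℚ) [W.IsElliptic] [W.IsGloballyMinimal] (hW : W = ⟨0, 1, 1, -954429, -339375850⟩)
    (Wd : WeierstrassCurve ℚ) [Wd.IsElliptic] [Wd.IsGloballyMinimal] (hWd : Wd = ⟨0, 1, 1, -3322368509, 69634225283225⟩)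
    (hrd : Wd.analyticRank = 1) (hL : (Wd.quadraticTwist ((-47 : ℤ) : ℚ)).entireLFunction 1 ≠ 0)
    (W'' : WeierstrassCurve ℚ) [W''.IsElliptic] [W''.IsGloballyMinimal] (hW'' : W'' = ⟨0, 1, 1, -7339112037117, -7229751597372885163⟩)
    (hunit : ∃ q : ℚ, shaAn W'' = (q : ℂ) ∧ padicValRat 3 q = 0)
    (W' : WeierstrassCurve ℚ) [W'.IsElliptic] [W'.IsGloballyMinimal] (hiso : IsIsogenous W W') :
    ∃ (W₁ : WeierstrassCurve ℚ) (_ : W₁.IsElliptic) (_ : W₁.IsGloballyMinimal)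
      (W₃ : WeierstrassCurve ℚ) (_ : W₃.IsElliptic) (_ : W₃.IsGloballyMinimal)
      (Wc : WeierstrassCurve ℚ) (_ : Wc.IsElliptic) (_ : Wc.IsGloballyMinimal),
      IsIsogenous W' W₁ ∧
      Relation.ReflTransGen (fun A B : WeierstrassCurve ℚ ↦ TwoStepAt 3 A B ∨
        (TwoStepAt 3 B A ∧ ∃ (_ : B.IsElliptic) (_ : B.IsGloballyMinimal), X2.CellB B 3)) W₁ W₃ ∧
      IsIsogenous W₃ Wc ∧
      ∃ q : ℚ, shaAn Wc = (q : ℂ) ∧ padicValRat 3 q = 0 := by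
  obtain ⟨W₁, _, _, W₃, _, _, Wc, _, _, hiso₁, hchain, hisoc, hq⟩ :=
    EisensteinPrimesMazurMCOnCellBTwistbackReachableCell105861e.reachableClassShaUnit_of_isIsogenous_105861e1 W hW Wd hWd hrd hL W'' hW'' hunit W' hiso
  exact ⟨W₁, inferInstance, inferInstance, W₃, inferInstance, inferInstance, Wc, inferInstance, inferInstance, hiso₁,
    zigzag_of_reflTransGen_twoStepAt hchain, hisoc, hq⟩

/-- **`(105861e1, 3)` and `(105861e2, 3)` — both Cremona members of class `105861e` — lie in v10's EXCLUDED population**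
(modulo the three readings): the identity isogeny (`WeierstrassCurve.isIsogenous_self`) resp. the tree's `X2.SecondDescentDisplay105861e.isIsogenous_E₁_E₂` fed to
`connectedClassShaUnit_of_isIsogenous_105861e1`. Fact-free; nothing booked. [cite: Velu1971] [cite: CremonaAlgorithms1997, Table 1 (class 105861e)] -/
theorem connectedClassShaUnit_105861e_members
    (W : WeierstrassCurve ℚ) [W.IsElliptic] [W.IsGloballyMinimal] (hW : W = ⟨0, 1, 1, -954429, -339375850⟩)
    (Wd : WeierstrassCurve ℚ) [Wd.IsElliptic] [Wd.IsGloballyMinimal] (hWd : Wd = ⟨0, 1, 1, -3322368509, 69634225283225⟩)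
    (hrd : Wd.analyticRank = 1) (hL : (Wd.quadraticTwist ((-47 : ℤ) : ℚ)).entireLFunction 1 ≠ 0)
    (W'' : WeierstrassCurve ℚ) [W''.IsElliptic] [W''.IsGloballyMinimal] (hW'' : W'' = ⟨0, 1, 1, -7339112037117, -7229751597372885163⟩)
    (hunit : ∃ q : ℚ, shaAn W'' = (q : ℂ) ∧ padicValRat 3 q = 0)
    (W₂ : WeierstrassCurve ℚ) [W₂.IsElliptic] [W₂.IsGloballyMinimal] (hW₂ : W₂ = ⟨0, 1, 1, -76115739, -255624765265⟩) :
    (∃ (W₁ : WeierstrassCurve ℚ) (_ : W₁.IsElliptic) (_ : W₁.IsGloballyMinimal)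
      (W₃ : WeierstrassCurve ℚ) (_ : W₃.IsElliptic) (_ : W₃.IsGloballyMinimal)
      (Wc : WeierstrassCurve ℚ) (_ : Wc.IsElliptic) (_ : Wc.IsGloballyMinimal),
      IsIsogenous W W₁ ∧
      Relation.ReflTransGen (fun A B : WeierstrassCurve ℚ ↦ TwoStepAt 3 A B ∨
        (TwoStepAt 3 B A ∧ ∃ (_ : B.IsElliptic) (_ : B.IsGloballyMinimal), X2.CellB B 3)) W₁ W₃ ∧
      IsIsogenous W₃ Wc ∧
      ∃ q : ℚ, shaAn Wc = (q : ℂ) ∧ padicValRat 3 q = 0) ∧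
    (∃ (W₁ : WeierstrassCurve ℚ) (_ : W₁.IsElliptic) (_ : W₁.IsGloballyMinimal)
      (W₃ : WeierstrassCurve ℚ) (_ : W₃.IsElliptic) (_ : W₃.IsGloballyMinimal)
      (Wc : WeierstrassCurve ℚ) (_ : Wc.IsElliptic) (_ : Wc.IsGloballyMinimal),
      IsIsogenous W₂ W₁ ∧
      Relation.ReflTransGen (fun A B : WeierstrassCurve ℚ ↦ TwoStepAt 3 A B ∨
        (TwoStepAt 3 B A ∧ ∃ (_ : B.IsElliptic) (_ : B.IsGloballyMinimal), X2.CellB B 3)) W₁ W₃ ∧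
      IsIsogenous W₃ Wc ∧
      ∃ q : ℚ, shaAn Wc = (q : ℂ) ∧ padicValRat 3 q = 0) := by
  have hiso : IsIsogenous W W₂ := by rw [hW₂, hW]; exact X2.SecondDescentDisplay105861e.isIsogenous_E₁_E₂
  exact ⟨connectedClassShaUnit_of_isIsogenous_105861e1 W hW Wd hWd hrd hL W'' hW'' hunit W (WeierstrassCurve.isIsogenous_self W),
    connectedClassShaUnit_of_isIsogenous_105861e1 W hW Wd hWd hrd hL W'' hW'' hunit W₂ hiso⟩

end Summit.BirchSwinnertonDyer.BirchSwinnertonDyer.Theorems.EisensteinPrimesMazurMCOnCellBTwistbackConnectedCells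

end
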